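import Summits.BirchSwinnertonDyer.BirchSwinnertonDyer.Theorems.EdixhovenFibreFiveSevenStarredOptimalManinUnitFiveSevenCdtThm1
import Summits.BirchSwinnertonDyer.BirchSwinnertonDyer.Theorems.AdditiveKolyvaginRoadManinFrameFromDatum
import Summits.BirchSwinnertonDyer.BirchSwinnertonDyer.Theses.AdditiveKolyvaginRoad
import HarnessLib

set_option autoImplicit false
-- the sub-problem namespace `Summit.BirchSwinnertonDyer.BirchSwinnertonDyer` duplicates a component by design (D-0017)
set_option linter.dupNamespace false

/-!
# Route AdditiveKolyvaginRoad: the Manin-good frame crux (stmt-BirchSwinnertonDyer-20136) and its residue items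
# (20094, 20483, R 20709), closed by name

The Manin side of route AdditiveKolyvaginRoad: at every additive prime `p ≥ 5` with `E[p]` irreducible and
`r_an = 1`, granted the route's own hypothesis-only bundle of published inputs (modularity, Hoffstein–Luo, … — the
decls' first binder), a Manin-good odd Hoffstein–Luo frame exists (`ManinGoodOddFrameAdditive`, crux #6); the residue
forms `ManinFrameResidueClass` (20094), `ManinFrameResidueProper` (20483) and R `ManinFrameResidueProperR` (20709,
the crux consumed by the deciding theorems of AdditiveKolyvaginRoad, TeichmullerTwistDescent and
EdixhovenFibreFiveSeven) are the same statement under extra (idle) class / residue clauses.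

The landed conditional closers `AdditiveKolyOfCDTInt.{maninGoodOddFrameAdditive, maninFrameResidueClass,
maninFrameResidueProper, maninFrameResidueProperR}_of_CDTInt` (LEAD edix-p1 g36: a conductor-level datum with
`p ∤ c` by `EdixhovenFibreFiveSevenOfCDTInt.exists_datum_not_dvd_c_of_CDTInt`, then the road's
`ManinFrameFromDatum.exists_oddHeegnerFrame_of_exists_not_dvd`) take exactly the printed Calegari–Dimitrov–Tang
Theorem 1.0.1 as hypothesis; that hypothesis is now the tree theorem
`calegariDimitrovTang2025_unboundedDenominators_holds` (p826028, line `cdt_thm1` of crux K★ of route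
EdixhovenFibreFiveSeven).  Composing proves all four items BY NAME; the four short proofs are INLINED here (verbatim,
with the key swapped for the theorem) so that this file imports the route file directly and no other module of its cone.

BSD is not proved by this; Manin's conjecture is not proved by this; no W-ALL class theorem is proved (the rung
W-ALL/2 still carries the Kolyvagin-side open cruxes 21400 / 20133 / 20134 / 20135). [cite: CalegariDimitrovTang2025, Thm. 1.0.1]
[cite: HoffsteinLuo1997, Thm.] [cite: EdixhovenManin1991, Thm. 3]
-/

namespace Summit.BirchSwinnertonDyer.BirchSwinnertonDyer.Theorems

/-- **Crux `ManinGoodOddFrameAdditive` (stmt-BirchSwinnertonDyer-20136), proved by name**: at every additive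
`p ≥ 5` with `E[p]` irreducible and `r_an = 1`, granted the decl's own bundle of published inputs, a Manin-good odd
Hoffstein–Luo frame exists — from CDT Theorem 1.0.1 (`calegariDimitrovTang2025_unboundedDenominators_holds`)
by the proof of `AdditiveKolyOfCDTInt.maninGoodOddFrameAdditive_of_CDTInt`, inlined
(`exists_datum_not_dvd_c_of_CDTInt` + `ManinFrameFromDatum.exists_oddHeegnerFrame_of_exists_not_dvd`).  BSD is NOT proved by this.
[cite: CalegariDimitrovTang2025, Thm. 1.0.1] [cite: HoffsteinLuo1997, Thm.] -/
theorem AdditiveKolyvaginRoad.ManinGoodOddFrameAdditive_proof :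
    Summit.BirchSwinnertonDyer.BirchSwinnertonDyer.Theses.AdditiveKolyvaginRoad.ManinGoodOddFrameAdditive := by
  intro hPub W _ _ p _ _ hp5 hadd hirr hr
  have hp2 : p ≠ 2 := by omega
  exact ManinFrameFromDatum.exists_oddHeegnerFrame_of_exists_not_dvd hPub.2.2.2.2.2.1 hPub.2.2.2.2.2.2.1 W p hr hp2
    (EdixhovenFibreFiveSevenOfCDTInt.exists_datum_not_dvd_c_of_CDTInt calegariDimitrovTang2025_unboundedDenominators_holds
      hPub.2.2.2.2.2.1 W p hp5 hadd hirr)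

/-- **Item `ManinFrameResidueClass` (stmt-BirchSwinnertonDyer-20094), proved by name** (the frame statement under
the idle exception / `Iₙ*` class clause) — from CDT Theorem 1.0.1 as in
`AdditiveKolyOfCDTInt.maninFrameResidueClass_of_CDTInt` (via `ManinGoodOddFrameAdditive_proof`).  BSD is NOT proved by this.
[cite: CalegariDimitrovTang2025, Thm. 1.0.1] -/
theorem AdditiveKolyvaginRoad.ManinFrameResidueClass_proof :
    Summit.BirchSwinnertonDyer.BirchSwinnertonDyer.Theses.AdditiveKolyvaginRoad.ManinFrameResidueClass := by
  intro hPub W _ _ p _ _ hp5 hadd hirr _hcl hr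
  exact AdditiveKolyvaginRoad.ManinGoodOddFrameAdditive_proof hPub W p hp5 hadd hirr hr

/-- **Item `ManinFrameResidueProper` (stmt-BirchSwinnertonDyer-20483), proved by name** (the frame statement under
the idle class clause and the idle «every degree divisible by `p`» clause) — from CDT Theorem 1.0.1 as in
`AdditiveKolyOfCDTInt.maninFrameResidueProper_of_CDTInt` (via `ManinGoodOddFrameAdditive_proof`).  BSD is NOT proved by this.
[cite: CalegariDimitrovTang2025, Thm. 1.0.1] -/
theorem AdditiveKolyvaginRoad.ManinFrameResidueProper_proof :
    Summit.BirchSwinnertonDyer.BirchSwinnertonDyer.Theses.AdditiveKolyvaginRoad.ManinFrameResidueProper := by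
  intro hPub W _ _ p _ _ hp5 hadd hirr _hcl _hall hr
  exact AdditiveKolyvaginRoad.ManinGoodOddFrameAdditive_proof hPub W p hp5 hadd hirr hr

/-- **Crux R `ManinFrameResidueProperR` (stmt-BirchSwinnertonDyer-20709), proved by name** (the frame statement
under the idle Edixhoven / Dokchitser antecedents and both residue clauses; consumed by three deciding theorems) —
from CDT Theorem 1.0.1 as in `AdditiveKolyOfCDTInt.maninFrameResidueProperR_of_CDTInt` (via `ManinGoodOddFrameAdditive_proof`).  BSD is NOT proved by
this. [cite: CalegariDimitrovTang2025, Thm. 1.0.1] -/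
theorem AdditiveKolyvaginRoad.ManinFrameResidueProperR_proof :
    Summit.BirchSwinnertonDyer.BirchSwinnertonDyer.Theses.AdditiveKolyvaginRoad.ManinFrameResidueProperR := by
  intro _e1 _e2 _dd hPub W _ _ p _ _ hp5 hadd hirr _hcl _hall hr
  exact AdditiveKolyvaginRoad.ManinGoodOddFrameAdditive_proof hPub W p hp5 hadd hirr hr

end Summit.BirchSwinnertonDyer.BirchSwinnertonDyer.Theorems
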